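import Summits.ResolutionOfSingularities.ResolutionOfSingularities.Theorems.FrobeniusLadderFRationalModificationFiniteMaxMultDefectModel
import HarnessLib

/-!
# A finite defect with blow-up certificates along `𝔪`-primary centres is resolved to rung 3 by one
# blowing up (crux `FrobeniusLadder.FRationalModification`, line `socle-discrepancy-certificate`, wave 4)

Support file for crux stmt-ResolutionOfSingularities-15316 (`FrobeniusLadder.FRationalModification`, route
`ResolutionOfSingularities/FrobeniusLadder`), line `socle-discrepancy-certificate`, registered sub-goal
`finiteBlowupCertifiedDefect_model` — the FINITE-DEFECT LOCAL-TO-GLOBAL PRINCIPLE FOR BLOW-UP CERTIFICATES,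
the provable core of the line's stub `stub_codimStep`; it generalises the canonical global step
`FiniteMaxMultDefectModel.finiteMaxMultDefect_model` (centre `𝔪_x` at each defect point) to arbitrary
`𝔪_x`-primary centres.

Let `Y` be an integral separated `k`-scheme of finite type (`char k = p`) whose non-F-rational locus (the set `T`
of points whose local ring fails the route's rung-3 clause "domain, every ideal generated by a system of
parameters tightly closed") is a FINITE set of CLOSED points, and suppose that at each `x ∈ T` some
`𝔪_x`-primary ideal `I_x ⊆ 𝒪_{Y,x}` has a pointwise-certified blowing up: every local ring of
`Bl_{I_x} Spec 𝒪_{Y,x} = affineBlowup I_x` is regular, or a domain with `t ∈ 𝔪 ∖ 0`, `𝒪[1/t]` regular and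
`𝒪/(t)` Cohen–Macaulay with Frobenius-closed parameter ideals. Then `Y` has a proper birational model all of
whose local rings are rung-3:

* `exists_idealSheafData_stalkIdeal_eq` — **gluing the local centres**: for a finite set `T` of closed points
  and ideals `I_x ⊇ 𝔪_x^N` (`x ∈ T`) there is ONE quasi-coherent ideal sheaf `J` with `J_x = I_x` on `T` and
  `J_x = 𝒪_{Y,x}` off `T`: `J(U) = {s | germ_x s ∈ I_x for all x ∈ T ∩ U}`; quasi-coherence `J(D(f)) = J(U)_f`
  holds because `f^N ∈ I_x` at the points `x ∈ T ∩ U ∖ D(f)`, and the stalks are computed on an affine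
  neighbourhood of `x` meeting `T` at most in `x`, where `𝒪_{Y,x}` is a localization of `Γ(U)`;
* `J ≠ 0` since the regular locus of the integral `Y` is dense and regular local rings are rung-3
  (`Negative.rungThree_of_isRegularLocalRing`), so `V(J) ⊆ T ≠ Y`;
* `π : W → Y` a blowing up along `J` (`exists_isBlowup`): proper (Stacks 02NS), birational with integral
  source (Stacks 02ND); off `T ⊇ V(J)` it does not change the local rings
  (`FiniteMaxMultDefectModel.isIso_stalkMap_of_not_mem_support`) and the rung-3 clause is invariant under ring
  isomorphisms; over `x ∈ T` the stalks of `W` are stalks of `Bl_{J_x} Spec 𝒪_{Y,x} = affineBlowup I_x`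
  (`FiniteMaxMultDefectModel.exists_stalk_ringEquiv_affineBlowup`, Görtz–Wedhorn Prop. 13.91 (2)), which are
  certified by hypothesis, and certified stalks of a `k`-scheme locally of finite type are rung-3
  (`CertifiedModel.rungThree_of_certificate`).

References: U. Görtz, T. Wedhorn, *Algebraic Geometry I* (2nd ed. 2020), Def. 13.90, Prop. 13.91, Prop. 13.92;
The Stacks Project, Tags 01J7, 02NS, 02OS, 02ND; R. Fedder, K.-i. Watanabe (1989), Prop. 2.13. [folklore]
-/

-- single-problem summit: the doubled namespace component `ResolutionOfSingularities` is forced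
set_option linter.dupNamespace false

noncomputable section

open CategoryTheory CategoryTheory.Limits AlgebraicGeometry TopologicalSpace IsLocalRing
open Literature.AlgebraicGeometry.Resolution Literature.RingTheory.TightClosure
open Summit.ResolutionOfSingularities.ResolutionOfSingularities.Theorems
open Summit.ResolutionOfSingularities.ResolutionOfSingularities.Theorems.FRationalModification
open Summit.ResolutionOfSingularities.ResolutionOfSingularities.Theorems.FRationalModification.FiniteMaxMultDefectModel

namespace Summit.ResolutionOfSingularities.ResolutionOfSingularities.Theorems.FRationalModification.FiniteBlowupCertifiedDefectModel

/-! ## §1 Gluing local centres at finitely many closed points into one ideal sheaf -/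

/-- **An ideal sheaf with prescribed `𝔪`-primary stalks at finitely many closed points.** For a finite set
`T` of closed points of a scheme `Y` and ideals `I_x ⊆ 𝒪_{Y,x}` with `𝔪_x^N ⊆ I_x` (`x ∈ T`), the sections
whose germs at the points of `T` lie in the `I_x` form a quasi-coherent ideal sheaf `J` with `J_x = I_x` for
`x ∈ T` and `J_x = 𝒪_{Y,x}` for `x ∉ T` (quasi-coherence `J(D(f)) = J(U)_f`: `f^N ∈ I_x` at the points of
`T ∩ U` outside `D(f)`; stalks: on an affine `U ∋ x` with `U ∩ T ⊆ {x}`, `J(U)` is the preimage of `I_x`,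
and `𝒪_{Y,x}` is a localization of `Γ(U)`). [folklore] -/
theorem exists_idealSheafData_stalkIdeal_eq {Y : Scheme.{0}} {T : Set Y} (hT : T.Finite)
    (hTc : ∀ x ∈ T, IsClosed ({x} : Set Y)) (I : ∀ x : Y, Ideal (Y.presheaf.stalk x)) (N : ℕ)
    (hN : ∀ x ∈ T, maximalIdeal (Y.presheaf.stalk x) ^ N ≤ I x) :
    ∃ J : Y.IdealSheafData, (∀ x ∈ T, stalkIdeal J x = I x) ∧ ∀ x ∉ T, stalkIdeal J x = ⊤ := by
  classical
  -- `K U`: the sections over `U` whose germ at each `x ∈ T ∩ U` lies in `I x`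
  let K : ∀ U : Y.affineOpens, Ideal Γ(Y, U) := fun U =>
    ⨅ (x : Y) (_ : x ∈ T) (hxU : x ∈ (U : Y.Opens)), (I x).comap (Y.presheaf.germ U x hxU).hom
  have hK : ∀ (U : Y.affineOpens) (s : Γ(Y, U)), s ∈ K U ↔
      ∀ x ∈ T, ∀ hxU : x ∈ (U : Y.Opens), (Y.presheaf.germ U x hxU).hom s ∈ I x := by
    intro U s
    simp only [K, Ideal.mem_iInf, Ideal.mem_comap]
  -- germs do not see restriction to a basic open
  have hgerm : ∀ (U : Y.affineOpens) (f : Γ(Y, U)) (x : Y) (hxf : x ∈ Y.basicOpen f) (s : Γ(Y, U)),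
      (Y.presheaf.germ (Y.basicOpen f) x hxf).hom ((Y.presheaf.map (homOfLE (Y.basicOpen_le f)).op).hom s) =
        (Y.presheaf.germ U x (Y.basicOpen_le f hxf)).hom s :=
    fun U f x hxf s => TopCat.Presheaf.germ_res_apply Y.presheaf (homOfLE (Y.basicOpen_le f)) x hxf s
  -- the restriction `Γ(U) → Γ(D(f))` is the structure map of the localization `Γ(D(f)) = Γ(U)_f`
  have halg : ∀ (U : Y.affineOpens) (f : Γ(Y, U)) (r : Γ(Y, U)),
      algebraMap Γ(Y, U) Γ(Y, Y.basicOpen f) r = (Y.presheaf.map (homOfLE (Y.basicOpen_le f)).op).hom r :=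
    fun U f r => rfl
  -- quasi-coherence: `K (D(f)) = K(U)_f`
  have hKf : ∀ (U : Y.affineOpens) (f : Γ(Y, U)),
      (K U).map (Y.presheaf.map (homOfLE <| Y.basicOpen_le f).op).hom = K (Y.affineBasicOpen f) := by
    intro U f
    apply le_antisymm
    · rw [Ideal.map_le_iff_le_comap]
      intro s hs
      rw [Ideal.mem_comap]
      refine (hK (Y.affineBasicOpen f) _).mpr fun x hxT hxf => ?_
      change (Y.presheaf.germ (Y.basicOpen f) x hxf).hom
          ((Y.presheaf.map (homOfLE (Y.basicOpen_le f)).op).hom s) ∈ I x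
      rw [hgerm U f x hxf s]
      exact (hK U s).mp hs x hxT (Y.basicOpen_le f hxf)
    · intro s hs
      letI := U.2.isLocalization_basicOpen f
      obtain ⟨⟨t, ⟨_, n, rfl⟩⟩, hst⟩ := IsLocalization.surj (Submonoid.powers f) s
      have hst' : s * algebraMap Γ(Y, U) Γ(Y, Y.basicOpen f) (f ^ n) =
          algebraMap Γ(Y, U) Γ(Y, Y.basicOpen f) t := hst
      -- `f ^ N * t ∈ K U`
      have hmem : f ^ N * t ∈ K U := by
        rw [hK]
        intro x hxT hxU
        rw [map_mul, map_pow]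
        by_cases hxf : x ∈ Y.basicOpen f
        · refine Ideal.mul_mem_left _ _ ?_
          -- `germ_x s ∈ I x` (the germ through `D(f)`, an affine open)
          have hsx : (Y.presheaf.germ (Y.basicOpen f) x hxf).hom s ∈ I x :=
            (hK (Y.affineBasicOpen f) s).mp hs x hxT hxf
          have h1 : (Y.presheaf.germ U x hxU).hom t =
              (Y.presheaf.germ (Y.basicOpen f) x hxf).hom s * (Y.presheaf.germ U x hxU).hom f ^ n := by
            have h2 := congrArg (Y.presheaf.germ (Y.basicOpen f) x hxf).hom hst'
            rw [map_mul, halg, halg, hgerm U f x hxf, hgerm U f x hxf, map_pow] at h2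
            exact h2.symm
          rw [h1]
          exact Ideal.mul_mem_right _ _ hsx
        · have hfm : (Y.presheaf.germ U x hxU).hom f ∈ maximalIdeal (Y.presheaf.stalk x) := by
            rw [IsLocalRing.mem_maximalIdeal, mem_nonunits_iff]
            exact fun hu => hxf ((Y.mem_basicOpen f x hxU).mpr hu)
          exact Ideal.mul_mem_right _ _ (hN x hxT (Ideal.pow_mem_pow hfm N))
      have key : s * algebraMap Γ(Y, U) Γ(Y, Y.basicOpen f) (f ^ (n + N)) =
          algebraMap Γ(Y, U) Γ(Y, Y.basicOpen f) (f ^ N * t) := by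
        rw [pow_add, map_mul, ← mul_assoc, hst', map_mul, mul_comm]
      have hu : IsUnit (algebraMap Γ(Y, U) Γ(Y, Y.basicOpen f) (f ^ (n + N))) :=
        IsLocalization.map_units (M := Submonoid.powers f) _ ⟨f ^ (n + N), n + N, rfl⟩
      obtain ⟨v, hv⟩ := hu.exists_right_inv
      have hs' : s = algebraMap Γ(Y, U) Γ(Y, Y.basicOpen f) (f ^ N * t) * v := by
        rw [← key, mul_assoc, hv, mul_one]
      rw [hs']
      exact Ideal.mul_mem_right _ _ (Ideal.mem_map_of_mem _ hmem)
  let J : Y.IdealSheafData := { ideal := K, map_ideal_basicOpen := hKf }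
  have hJU : ∀ U, J.ideal U = K U := fun U => rfl
  -- every point has an affine neighbourhood meeting `T` at most in itself
  have hnbhd : ∀ x : Y, ∃ U : Y.affineOpens, ∃ hxU : x ∈ (U : Y.Opens),
      ∀ y ∈ T, y ∈ (U : Y.Opens) → y = x := by
    intro x
    obtain ⟨U, hU, hxU, hUV⟩ := exists_isAffineOpen_mem_and_subset (X := Y) (x := x)
      (U := ⟨(T \ {x})ᶜ, (isClosed_diff_singleton_of_finite hT hTc x).isOpen_compl⟩)
      (fun h => h.2 (Set.mem_singleton x))
    refine ⟨⟨U, hU⟩, hxU, fun y hyT hyU => ?_⟩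
    by_contra hyx
    exact hUV hyU ⟨hyT, hyx⟩
  refine ⟨J, fun x hxT => ?_, fun x hxT => ?_⟩
  · -- at `x ∈ T`: `J(U) = germ_x⁻¹ I_x` on a good neighbourhood, and `𝒪_{Y,x}` is a localization of `Γ(U)`
    obtain ⟨U, hxU, hU⟩ := hnbhd x
    have hKU : K U = (I x).comap (Y.presheaf.germ U x hxU).hom := by
      apply le_antisymm
      · intro s hs
        exact (hK U s).mp hs x hxT hxU
      · intro s hs
        rw [hK]
        intro y hyT hyU
        obtain rfl := hU y hyT hyU
        exact hs
    rw [stalkIdeal_eq_map_germ J U hxU, hJU, hKU]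
    letI : Algebra Γ(Y, U) (Y.presheaf.stalk x) :=
      TopCat.Presheaf.algebra_section_stalk Y.presheaf ⟨x, hxU⟩
    haveI : IsLocalization.AtPrime (Y.presheaf.stalk x) (U.2.primeIdealOf ⟨x, hxU⟩).asIdeal :=
      U.2.isLocalization_stalk ⟨x, hxU⟩
    exact IsLocalization.map_under (U.2.primeIdealOf ⟨x, hxU⟩).asIdeal.primeCompl
      (Y.presheaf.stalk x) (I x)
  · -- off `T`: `J(U) = Γ(U)` on a neighbourhood missing `T`
    obtain ⟨U, hxU, hU⟩ := hnbhd x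
    have hKU : K U = ⊤ := by
      rw [eq_top_iff]
      intro s _
      rw [hK]
      intro y hyT hyU
      obtain rfl := hU y hyT hyU
      exact absurd hyT hxT
    rw [stalkIdeal_eq_map_germ J U hxU, hJU, hKU, Ideal.map_top]

/-! ## §2 The finite-defect local-to-global principle for blow-up certificates -/

/-- W4a — **FINITE-DEFECT LOCAL-TO-GLOBAL FOR BLOW-UP CERTIFICATES** (registered sub-goal
`finiteBlowupCertifiedDefect_model` of crux stmt-ResolutionOfSingularities-15316, line
`socle-discrepancy-certificate`; the provable core of `stub_codimStep`): an integral separated finite-type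
`Y/k` whose defect is a finite set `T` of closed points, at each of which SOME `𝔪ₓ`-primary ideal
`I ⊆ 𝒪_{Y,x}` has a pointwise-certified blow-up `affineBlowup I`, has a proper birational model with rung-3
stalks — glue the local centres into one ideal sheaf `J` with `J_x = I` on `T` and `J = 𝒪` off `T`
(`exists_idealSheafData_stalkIdeal_eq`), blow it up, compare stalks over `x ∈ T` with `affineBlowup I`
(`exists_stalk_ringEquiv_affineBlowup`) and consume the certificates (`CertifiedModel.rungThree_of_certificate`);
off `T` nothing changes. Generalises `finiteMaxMultDefect_model` (`I = 𝔪ₓ`).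
[cite: GortzWedhorn2020, Prop. 13.91; FedderWatanabe1989, Prop. 2.13] -/
theorem finiteBlowupCertifiedDefect_model
    (p : ℕ) [Fact p.Prime] (k : Type) [Field k] [CharP k p] (Y : Scheme.{0}) (g : Y ⟶ Spec (.of k))
    [IsSeparated g] [LocallyOfFiniteType g] [QuasiCompact g] [IsIntegral Y] (T : Set Y) (hT : T.Finite) (hTc
    : ∀ x ∈ T, IsClosed ({x} : Set Y)) (hdef : ∀ x : Y, x ∈ T ↔ ¬ (IsDomain (Y.presheaf.stalk x) ∧ ∀ d : ℕ,
    ringKrullDim (Y.presheaf.stalk x) = d → ∀ s : Fin d → Y.presheaf.stalk x, (Ideal.span (Set.range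
    s)).radical.IsMaximal → ∀ y c : Y.presheaf.stalk x, c ≠ 0 → (∀ e : ℕ, c * y ^ p ^ e ∈ Ideal.span ((fun z
    : Y.presheaf.stalk x => z ^ p ^ e) '' (Ideal.span (Set.range s) : Set (Y.presheaf.stalk x)))) → y ∈
    Ideal.span (Set.range s))) (hcert : ∀ x ∈ T, ∃ I : Ideal (Y.presheaf.stalk x), I ≤
    IsLocalRing.maximalIdeal (Y.presheaf.stalk x) ∧ IsLocalRing.maximalIdeal (Y.presheaf.stalk x) ≤
    I.radical ∧ ∀ w : affineBlowup I, IsRegularLocalRing ((affineBlowup I).presheaf.stalk w) ∨ (IsDomain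
    ((affineBlowup I).presheaf.stalk w) ∧ ∃ t : (affineBlowup I).presheaf.stalk w, t ∈
    IsLocalRing.maximalIdeal ((affineBlowup I).presheaf.stalk w) ∧ t ≠ 0 ∧ IsRegularRing (Localization.Away
    t) ∧ ∀ d : ℕ, ringKrullDim (((affineBlowup I).presheaf.stalk w) ⧸ Ideal.span {t}) = d → ∀ s : Fin d →
    ((affineBlowup I).presheaf.stalk w) ⧸ Ideal.span {t}, (Ideal.span (Set.range s)).radical.IsMaximal →
    RingTheory.Sequence.IsWeaklyRegular (((affineBlowup I).presheaf.stalk w) ⧸ Ideal.span {t}) (List.ofFn s)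
    ∧ ∀ y : ((affineBlowup I).presheaf.stalk w) ⧸ Ideal.span {t}, (∃ e : ℕ, y ^ p ^ e ∈ Ideal.span ((fun z :
    ((affineBlowup I).presheaf.stalk w) ⧸ Ideal.span {t} => z ^ p ^ e) '' (Ideal.span (Set.range s) : Set
    (((affineBlowup I).presheaf.stalk w) ⧸ Ideal.span {t})))) → y ∈ Ideal.span (Set.range s))) : ∃ (Y₂ :
    Scheme.{0}) (π : Y₂ ⟶ Y), IsProper π ∧ IsBirational π ∧ ∀ x : Y₂, IsDomain (Y₂.presheaf.stalk x) ∧ ∀ d :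
    ℕ, ringKrullDim (Y₂.presheaf.stalk x) = d → ∀ s : Fin d → Y₂.presheaf.stalk x, (Ideal.span (Set.range
    s)).radical.IsMaximal → ∀ y c : Y₂.presheaf.stalk x, c ≠ 0 → (∀ e : ℕ, c * y ^ p ^ e ∈ Ideal.span ((fun
    z : Y₂.presheaf.stalk x => z ^ p ^ e) '' (Ideal.span (Set.range s) : Set (Y₂.presheaf.stalk x)))) → y ∈
    Ideal.span (Set.range s) := by
  classical
  have hp : p.Prime := Fact.out
  haveI : IsLocallyNoetherian Y := LocallyOfFiniteType.isLocallyNoetherian g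
  -- regular points of `Y` are rung-3, hence not in `T`
  have hreg : ∀ x : Y, IsRegularLocalRing (Y.presheaf.stalk x) → x ∉ T := fun x hx hxT => by
    haveI := Negative.charP_stalk g x
    exact (hdef x).mp hxT (Negative.rungThree_of_isRegularLocalRing hp _ hx)
  -- the local centres (extended arbitrarily off `T`) and a uniform exponent `𝔪_x ^ N ≤ I x` on `T`
  choose! I hI using hcert
  obtain ⟨N, hN⟩ : ∃ N : ℕ, ∀ x ∈ T, maximalIdeal (Y.presheaf.stalk x) ^ N ≤ I x := by
    have hpow : ∀ x ∈ T, ∃ n : ℕ, maximalIdeal (Y.presheaf.stalk x) ^ n ≤ I x := fun x hx =>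
      Ideal.exists_pow_le_of_le_radical_of_fg (hI x hx).2.1 (IsNoetherian.noetherian _)
    choose! n hn using hpow
    exact ⟨hT.toFinset.sup n, fun x hx =>
      (Ideal.pow_le_pow_right (Finset.le_sup (hT.mem_toFinset.mpr hx))).trans (hn x hx)⟩
  -- the global centre `J`: `J_x = I x` on `T`, the unit ideal off `T`
  obtain ⟨J, hJT, hJT'⟩ := exists_idealSheafData_stalkIdeal_eq hT hTc I N hN
  have hsupp : ∀ x : Y, x ∈ J.support → x ∈ T := fun x hx => by
    by_contra hxT
    have h := (mem_support_iff_stalkIdeal_le J x).mp hx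
    rw [hJT' x hxT, top_le_iff] at h
    exact (maximalIdeal.isMaximal (Y.presheaf.stalk x)).ne_top h
  have hJ : J ≠ ⊥ := by
    intro h
    obtain ⟨x, hx⟩ := (Scheme.dense_regularLocus Y).nonempty
    have hs : (J.support : Set Y) = Set.univ := by
      rw [h, Scheme.IdealSheafData.support_bot]
      rfl
    exact hreg x hx (hsupp x (show x ∈ (J.support : Set Y) from hs ▸ Set.mem_univ x))
  -- the blowing up of `Y` along `J`
  obtain ⟨W, π, hπ⟩ := exists_isBlowup Y J
  haveI : IsIntegral W := hπ.isIntegral hJ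
  haveI : IsProper π := hπ.isProper
  refine ⟨W, π, inferInstance, hπ.isBirational' hJ, fun w => ?_⟩
  haveI := Negative.charP_stalk (π ≫ g) w
  by_cases hw : π w ∈ T
  · -- over a point of `T`: the stalk is a stalk of `Bl_{I x} Spec 𝒪_{Y, π w}`, certified by hypothesis
    obtain ⟨-, -, hgood⟩ := hI (π w) hw
    obtain ⟨y, ⟨E⟩⟩ := exists_stalk_ringEquiv_affineBlowup hπ (hJT (π w) hw) (w := w) rfl
    rcases MaxMultiplicityCertificate.good_of_ringEquiv p E.symm (hgood y) with
      hreg' | ⟨-, t, htm, ht0, hregt, hcl⟩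
    · exact Negative.rungThree_of_isRegularLocalRing hp _ hreg'
    · exact ⟨inferInstance,
        CertifiedModel.rungThree_of_certificate p (π ≫ g) w (Or.inr ⟨t, htm, ht0, hregt, hcl⟩)⟩
  · -- off `T`: `π` is a local isomorphism at `w`, and `𝒪_{Y, π w}` is rung-3 by `hdef`
    have hw' : π w ∉ (J.support : Set Y) := fun h => hw (hsupp _ h)
    haveI := isIso_stalkMap_of_not_mem_support hπ w hw'
    have h3 : IsDomain (Y.presheaf.stalk (π w)) ∧ ∀ d : ℕ, ringKrullDim (Y.presheaf.stalk (π w)) = d →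
        ∀ s : Fin d → Y.presheaf.stalk (π w), (Ideal.span (Set.range s)).radical.IsMaximal →
        ∀ y c : Y.presheaf.stalk (π w), c ≠ 0 → (∀ e : ℕ, c * y ^ p ^ e ∈
          Ideal.span ((fun z : Y.presheaf.stalk (π w) => z ^ p ^ e) ''
            (Ideal.span (Set.range s) : Set (Y.presheaf.stalk (π w))))) → y ∈ Ideal.span (Set.range s) := by
      by_contra h
      exact hw ((hdef (π w)).mpr h)
    exact FRationalResolution.ClauseInvariance.stub_clause_of_ringEquiv p
      (asIso (π.stalkMap w)).commRingCatIsoToRingEquiv h3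

end Summit.ResolutionOfSingularities.ResolutionOfSingularities.Theorems.FRationalModification.FiniteBlowupCertifiedDefectModel

end
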